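import Summits.AnomalousDissipation.AnomalousDissipation.Theorems.SolenoidalFractalHomogenisationPermissibleFractalCarrierLayers

/-!
# Word carriers and level fields of a fractal shear carrier: size, Hölder and divergence bounds
(route `AnomalousDissipation/SolenoidalFractalHomogenisation`, crux K3 = stmt-AnomalousDissipation-19073
`PermissibleFractalCarrier`, towards the registered stub `stub_regular`; support seat ad-sawtooth-support g7)

Sequel of `…PermissibleFractalCarrierLayers` (one rescaled Kolmogorov layer):

* §4 the word carrier at a fixed time rescaled to `n` cells, `x ↦ B(s, n • x)`: smooth, `‖·‖ ≤ k/(2π)`,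
  `‖∂ⱼ·‖ ≤ k n`, Lipschitz `3√3 kn`, (weakly) divergence free, and `‖·‖_∞ + [·]_r ≤ 7 k n^r` for `r ≤ 1`,
  `n ≥ 1` (interpolation at scale `1/n` between the sup bound and the Lipschitz bound);
* §5 the level `m` field `a_m • cell_{N_m}` of a fractal-carrier datum: `‖level m t x‖ ≤ k a_m /(2π N_m)`,
  weakly divergence free, smooth, `C^{0,r}` norm `≤ 7 k a_m N_m^{r−1}`.
-/

set_option linter.dupNamespace false

noncomputable section

namespace Summit.AnomalousDissipation.AnomalousDissipation.Theorems.SolenoidalFractalHomogenisation.PermissibleCarrier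

open Set Filter Topology MeasureTheory Complex
open scoped InnerProductSpace ENNReal NNReal ContDiff
open Literature.Analysis Literature.Analysis.FunctionSpaces Literature.Analysis.FunctionSpaces.Torus
open Literature.Analysis.FluidPDE Literature.Analysis.FluidPDE.LatticeShear

/-! ## §4 Envelope-weighted layer combinations and the word carrier at a fixed time -/

section Word

variable {k : ℕ}

/-- Finite sums of smooth functions (real normed target) are smooth. [folklore] -/
theorem isSmooth_fun_sum {ι : Type*} (s : Finset ι) {F : Type*} [NormedAddCommGroup F] [NormedSpace ℝ F]
    {d : Type*} [Fintype d] {f : ι → UnitAddTorus d → F} (h : ∀ i ∈ s, IsSmooth (f i)) :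
    IsSmooth fun x => ∑ i ∈ s, f i x := by
  unfold IsSmooth at *
  unfold Literature.Analysis.FunctionSpaces.Torus.lift at *
  simp only [Function.comp_def] at *
  exact ContDiff.sum fun i hi => h i hi

/-- A real combination of the rescaled layers of a word is smooth. [folklore] -/
theorem isSmooth_layerComb (W : LatticeWord k) (c : Fin k → ℝ) (n : ℕ) :
    IsSmooth fun x : UnitAddTorus (Fin 3) => ∑ j, c j • (W.phase j).layer (n • x) :=
  isSmooth_fun_sum _ fun j _ => (isSmooth_layer_nsmul (W.phase j) n).smul _

/-- `‖Σⱼ cⱼ layerⱼ(n • x)‖ ≤ (Σⱼ |cⱼ|)/(2π)`. [folklore] -/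
theorem norm_layerComb_le (W : LatticeWord k) (c : Fin k → ℝ) (n : ℕ) (x : UnitAddTorus (Fin 3)) :
    ‖∑ j, c j • (W.phase j).layer (n • x)‖ ≤ (∑ j, |c j|) / (2 * Real.pi) := by
  refine (norm_sum_le _ _).trans ?_
  rw [Finset.sum_div]
  refine Finset.sum_le_sum fun j _ => ?_
  rw [norm_smul, Real.norm_eq_abs, div_eq_mul_one_div]
  exact mul_le_mul_of_nonneg_left (norm_layer_nsmul_le _ _ _) (abs_nonneg _)

/-- `‖∂ᵢ (Σⱼ cⱼ layerⱼ(n • ·))(x)‖ ≤ (Σⱼ |cⱼ|) n`. [folklore] -/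
theorem norm_partialDeriv_layerComb_le (W : LatticeWord k) (c : Fin k → ℝ) (n : ℕ) (i : Fin 3)
    (x : UnitAddTorus (Fin 3)) :
    ‖Torus.partialDeriv i (fun y : UnitAddTorus (Fin 3) => ∑ j, c j • (W.phase j).layer (n • y)) x‖ ≤
      (∑ j, |c j|) * n := by
  have h1 : ∀ j ∈ (Finset.univ : Finset (Fin k)), IsContDiff 1 (fun y : UnitAddTorus (Fin 3) =>
      c j • (W.phase j).layer (n • y)) :=
    fun j _ => ((isSmooth_layer_nsmul (W.phase j) n).smul _).isContDiff (by simp)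
  rw [partialDeriv_finset_sum _ h1]
  refine (norm_sum_le _ _).trans ?_
  rw [Finset.sum_mul]
  refine Finset.sum_le_sum fun j _ => ?_
  have e : (fun y : UnitAddTorus (Fin 3) => c j • (W.phase j).layer (n • y)) =
      c j • (fun y : UnitAddTorus (Fin 3) => (W.phase j).layer (n • y)) := rfl
  rw [e, partialDeriv_const_smul ((isSmooth_layer_nsmul (W.phase j) n).isContDiff (by simp)), Pi.smul_apply,
    norm_smul, Real.norm_eq_abs]
  exact mul_le_mul_of_nonneg_left (norm_partialDeriv_layer_nsmul_le _ _ _ _) (abs_nonneg _)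

/-- A layer combination is Lipschitz with constant `√3 · 3 (Σ|cⱼ|) n`. [folklore] -/
theorem lipschitzWith_layerComb (W : LatticeWord k) (c : Fin k → ℝ) (n : ℕ) :
    LipschitzWith (NNReal.sqrt 3 * (3 * ((∑ j, |c j|).toNNReal * n)))
      (fun y : UnitAddTorus (Fin 3) => ∑ j, c j • (W.phase j).layer (n • y)) := by
  have hS : ((∑ j, |c j|).toNNReal : ℝ) = ∑ j, |c j| := Real.coe_toNNReal _ (Finset.sum_nonneg fun j _ => abs_nonneg _)
  have h := lipschitzWith_of_norm_partialDeriv_le (d := Fin 3) ((isSmooth_layerComb W c n).isContDiff (by simp))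
    (M := fun _ => (∑ j, |c j|).toNNReal * n) (fun i x => by
      push_cast; rw [hS]; exact norm_partialDeriv_layerComb_le W c n i x)
  simpa [Finset.sum_const, Finset.card_univ, Fintype.card_fin] using h

/-- A layer combination is divergence free. [folklore] -/
theorem isDivFree_layerComb (W : LatticeWord k) (c : Fin k → ℝ) (n : ℕ) :
    IsDivFree fun y : UnitAddTorus (Fin 3) => ∑ j, c j • (W.phase j).layer (n • y) := by
  intro x
  have hs := isSmooth_layerComb W c n
  rw [divergence_eq_sum_partialDeriv_apply (hs.isContDiff (by simp))]
  have h1 : ∀ j ∈ (Finset.univ : Finset (Fin k)), IsContDiff 1 (fun y : UnitAddTorus (Fin 3) =>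
      c j • (W.phase j).layer (n • y)) :=
    fun j _ => ((isSmooth_layer_nsmul (W.phase j) n).smul _).isContDiff (by simp)
  have e : ∀ i : Fin 3, Torus.partialDeriv i (fun y : UnitAddTorus (Fin 3) => ∑ j, c j • (W.phase j).layer (n • y)) x i =
      ∑ j : Fin k, c j * Torus.partialDeriv i (fun y : UnitAddTorus (Fin 3) => (W.phase j).layer (n • y)) x i := by
    intro i
    rw [partialDeriv_finset_sum _ h1, WithLp.ofLp_sum, Finset.sum_apply]
    refine Finset.sum_congr rfl fun j _ => ?_
    have e : (fun y : UnitAddTorus (Fin 3) => c j • (W.phase j).layer (n • y)) =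
        c j • (fun y : UnitAddTorus (Fin 3) => (W.phase j).layer (n • y)) := rfl
    rw [e, partialDeriv_const_smul ((isSmooth_layer_nsmul (W.phase j) n).isContDiff (by simp)), Pi.smul_apply,
      WithLp.ofLp_smul, Pi.smul_apply, smul_eq_mul]
  simp_rw [e]
  rw [Finset.sum_comm]
  refine Finset.sum_eq_zero fun j _ => ?_
  rw [← Finset.mul_sum]
  have hd := isDivFree_layer_nsmul (W.phase j) n x
  rw [divergence_eq_sum_partialDeriv_apply ((isSmooth_layer_nsmul (W.phase j) n).isContDiff (by simp))] at hd
  rw [hd, mul_zero]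

/-- A layer combination is weakly divergence free. [folklore] -/
theorem isWeaklyDivFree_layerComb (W : LatticeWord k) (c : Fin k → ℝ) (n : ℕ) :
    IsWeaklyDivFree fun y : UnitAddTorus (Fin 3) => ∑ j, c j • (W.phase j).layer (n • y) :=
  (isDivFree_layerComb W c n).isWeaklyDivFree_holds (isSmooth_layerComb W c n)

/-- **`C^{0,r}` bound of a layer combination**: for `r ≤ 1` and `n ≥ 1`,
`‖G‖_∞ + [G]_r ≤ 7 (Σⱼ|cⱼ|) n^r` (sup `≤ Σ|c|/(2π)`, Lipschitz `≤ 3√3 Σ|c| n`, oscillation `≤ Σ|c|/π`;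
interpolation at scale `1/n`). [cite: GilbargTrudinger2001, §4.1 and (6.8)–(6.9) (interpolation of Hölder norms)] -/
theorem eBoundedHolderNorm_layerComb_le (W : LatticeWord k) (c : Fin k → ℝ) {n : ℕ} (hn : 1 ≤ n) {r : ℝ≥0}
    (hr : r ≤ 1) :
    eBoundedHolderNorm r (fun y : UnitAddTorus (Fin 3) => ∑ j, c j • (W.phase j).layer (n • y)) ≤
      ENNReal.ofReal (7 * (∑ j, |c j|) * (n : ℝ) ^ (r : ℝ)) := by
  set S : ℝ := ∑ j, |c j| with hSdef
  have hS0 : 0 ≤ S := Finset.sum_nonneg fun j _ => abs_nonneg _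
  have hn0 : (0 : ℝ) < n := by exact_mod_cast hn
  have hkn : (1 : ℝ) ≤ (n : ℝ) ^ (r : ℝ) := Real.one_le_rpow (by exact_mod_cast hn) r.2
  -- sup part
  have hsup : eSupNorm (fun y : UnitAddTorus (Fin 3) => ∑ j, c j • (W.phase j).layer (n • y)) ≤
      ENNReal.ofReal (S / (2 * Real.pi)) := by
    refine iSup_le fun x => ?_
    rw [← ofReal_norm]
    exact ENNReal.ofReal_le_ofReal (norm_layerComb_le W c n x)
  -- Hölder part by interpolation at scale `1/n`
  have hL := lipschitzWith_layerComb W c n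
  have hST : ((S.toNNReal : ℝ≥0) : ℝ) = S := Real.coe_toNNReal _ hS0
  set Bk : ℝ≥0 := (S / Real.pi).toNNReal with hBk
  have hBk' : (Bk : ℝ) = S / Real.pi := Real.coe_toNNReal _ (by positivity)
  have hB : ∀ x y : UnitAddTorus (Fin 3), edist (∑ j, c j • (W.phase j).layer (n • x))
      (∑ j, c j • (W.phase j).layer (n • y)) ≤ (Bk : ℝ≥0∞) := by
    intro x y
    rw [edist_eq_enorm_sub, ← ofReal_norm, ← ENNReal.ofReal_coe_nnreal, hBk']
    refine ENNReal.ofReal_le_ofReal ?_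
    calc ‖∑ j, c j • (W.phase j).layer (n • x) - ∑ j, c j • (W.phase j).layer (n • y)‖
        ≤ ‖∑ j, c j • (W.phase j).layer (n • x)‖ + ‖∑ j, c j • (W.phase j).layer (n • y)‖ := norm_sub_le _ _
      _ ≤ S / (2 * Real.pi) + S / (2 * Real.pi) := add_le_add (norm_layerComb_le _ _ _ _) (norm_layerComb_le _ _ _ _)
      _ = S / Real.pi := by ring
  have hδ : (0 : ℝ≥0) < (n : ℝ≥0)⁻¹ := by
    have : (0 : ℝ≥0) < n := by exact_mod_cast hn
    exact inv_pos.2 this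
  have hH := (holderWith_of_lipschitzWith_of_edist_le hL hB hr hδ).eHolderNorm_le
  -- evaluate the interpolation constant
  have hconst : (((NNReal.sqrt 3 * (3 * (S.toNNReal * n))) * ((n : ℝ≥0)⁻¹) ^ (1 - r : ℝ) +
      Bk * (((n : ℝ≥0)⁻¹)⁻¹) ^ (r : ℝ) : ℝ≥0) : ℝ) = (Real.sqrt 3 * 3 * S + S / Real.pi) * (n : ℝ) ^ (r : ℝ) := by
    rw [inv_inv]
    push_cast
    rw [hBk', hST]
    have e1 : (n : ℝ) * ((n : ℝ)⁻¹) ^ (1 - (r : ℝ)) = (n : ℝ) ^ (r : ℝ) := by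
      rw [Real.inv_rpow hn0.le, ← Real.rpow_neg hn0.le, show -(1 - (r : ℝ)) = (r : ℝ) - 1 by ring,
        Real.rpow_sub hn0, Real.rpow_one]
      field_simp
    calc Real.sqrt 3 * (3 * (S * n)) * ((n : ℝ)⁻¹) ^ (1 - (r : ℝ)) + S / Real.pi * (n : ℝ) ^ (r : ℝ)
        = Real.sqrt 3 * 3 * S * ((n : ℝ) * ((n : ℝ)⁻¹) ^ (1 - (r : ℝ))) + S / Real.pi * (n : ℝ) ^ (r : ℝ) := by ring
      _ = _ := by rw [e1]; ring
  have hHr : eHolderNorm r (fun y : UnitAddTorus (Fin 3) => ∑ j, c j • (W.phase j).layer (n • y)) ≤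
      ENNReal.ofReal ((Real.sqrt 3 * 3 * S + S / Real.pi) * (n : ℝ) ^ (r : ℝ)) := by
    refine hH.trans (le_of_eq ?_)
    rw [← ENNReal.ofReal_coe_nnreal, hconst]
  -- assemble: `1/(2π) + 3√3 + 1/π ≤ 7`
  rw [eBoundedHolderNorm]
  refine (add_le_add hsup hHr).trans ?_
  rw [← ENNReal.ofReal_add (by positivity) (by positivity)]
  refine ENNReal.ofReal_le_ofReal ?_
  have hs3 : Real.sqrt 3 ≤ 2 := by
    rw [show (2 : ℝ) = Real.sqrt 4 by rw [show (4:ℝ) = 2 ^ 2 by norm_num, Real.sqrt_sq (by norm_num)]]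
    exact Real.sqrt_le_sqrt (by norm_num)
  have hπ : 1 / Real.pi ≤ 1 / 3 := div_le_div_of_nonneg_left zero_le_one (by norm_num) Real.pi_gt_three.le
  have h1 : S / (2 * Real.pi) ≤ S / (2 * Real.pi) * (n : ℝ) ^ (r : ℝ) :=
    le_mul_of_one_le_right (by positivity) hkn
  have h2 : S / (2 * Real.pi) = S * (1 / Real.pi) / 2 := by ring
  have h3 : S / Real.pi = S * (1 / Real.pi) := by ring
  nlinarith [mul_nonneg hS0 (le_trans zero_le_one hkn),
    mul_nonneg (mul_nonneg hS0 (le_trans zero_le_one hkn)) (show (0:ℝ) ≤ 1 / Real.pi by positivity)]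

/-- The word carrier at time `s`, read at the scaled point `n • x`, is the envelope-weighted layer combination.
[cite: ArmstrongVicol2025, §3 (alternating-shear fractal carrier)] -/
theorem carrier_nsmul_apply (W : LatticeWord k) (s : ℝ) (n : ℕ) (x : UnitAddTorus (Fin 3)) :
    W.carrier s (n • x) = ∑ j, LatticeWord.trapezoid (W.start j) (W.phase j).τ W.ramp
      (Int.fract (s / W.period) * W.period) • (W.phase j).layer (n • x) := rfl

/-- Differences of the word carrier at two times are layer combinations with coefficients the envelope
differences. [folklore] -/
theorem carrier_nsmul_sub (W : LatticeWord k) (s s' : ℝ) (n : ℕ) (x : UnitAddTorus (Fin 3)) :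
    W.carrier s (n • x) - W.carrier s' (n • x) = ∑ j,
      (LatticeWord.trapezoid (W.start j) (W.phase j).τ W.ramp (Int.fract (s / W.period) * W.period) -
        LatticeWord.trapezoid (W.start j) (W.phase j).τ W.ramp (Int.fract (s' / W.period) * W.period)) •
      (W.phase j).layer (n • x) := by
  rw [carrier_nsmul_apply, carrier_nsmul_apply, ← Finset.sum_sub_distrib]
  refine Finset.sum_congr rfl fun j _ => ?_
  rw [sub_smul]

/-- The envelope sum is at most `k`. [folklore] -/
theorem sum_abs_trapezoid_le (W : LatticeWord k) (σ : ℝ) :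
    ∑ j : Fin k, |LatticeWord.trapezoid (W.start j) (W.phase j).τ W.ramp σ| ≤ k := by
  calc ∑ j : Fin k, |LatticeWord.trapezoid (W.start j) (W.phase j).τ W.ramp σ| ≤ ∑ j : Fin k, (1 : ℝ) :=
        Finset.sum_le_sum fun j _ => abs_trapezoid_le_one _ _ _ _
    _ = k := by simp

/-- The rescaled word carrier at a fixed time is smooth in space. [folklore] -/
theorem isSmooth_carrier_nsmul (W : LatticeWord k) (s : ℝ) (n : ℕ) :
    IsSmooth fun x : UnitAddTorus (Fin 3) => W.carrier s (n • x) :=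
  isSmooth_layerComb W _ n

/-- `‖B(s, n • x)‖ ≤ k/(2π)`. [folklore] -/
theorem norm_carrier_nsmul_le (W : LatticeWord k) (s : ℝ) (n : ℕ) (x : UnitAddTorus (Fin 3)) :
    ‖W.carrier s (n • x)‖ ≤ k / (2 * Real.pi) :=
  (norm_layerComb_le W _ n x).trans (div_le_div_of_nonneg_right (sum_abs_trapezoid_le W _) (by positivity))

/-- The rescaled word carrier at a fixed time is weakly divergence free. [folklore] -/
theorem isWeaklyDivFree_carrier_nsmul (W : LatticeWord k) (s : ℝ) (n : ℕ) :
    IsWeaklyDivFree fun y : UnitAddTorus (Fin 3) => W.carrier s (n • y) :=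
  isWeaklyDivFree_layerComb W _ n

/-- `‖B(s, n•·)‖_{C^{0,r}} ≤ 7 k n^r` (`r ≤ 1`, `n ≥ 1`). [folklore] -/
theorem eBoundedHolderNorm_carrier_nsmul_le (W : LatticeWord k) (s : ℝ) {n : ℕ} (hn : 1 ≤ n) {r : ℝ≥0}
    (hr : r ≤ 1) :
    eBoundedHolderNorm r (fun y : UnitAddTorus (Fin 3) => W.carrier s (n • y)) ≤
      ENNReal.ofReal (7 * k * (n : ℝ) ^ (r : ℝ)) := by
  refine (eBoundedHolderNorm_layerComb_le W _ hn hr).trans (ENNReal.ofReal_le_ofReal ?_)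
  have h0 : (0 : ℝ) ≤ (n : ℝ) ^ (r : ℝ) := by positivity
  nlinarith [mul_le_mul_of_nonneg_right (sum_abs_trapezoid_le W (Int.fract (s / W.period) * W.period)) h0]

end Word

/-! ## §5 The level fields of a fractal-carrier datum -/

section Level

variable {k : ℕ}

/-- The level `m` field is the rescaled word carrier times `a_m / N_m`. [cite: ArmstrongVicol2025, §3] -/
theorem level_eq_smul (D : FractalCarrierData k) (m : ℕ) (t : ℝ) :
    D.level m t = (D.a m / (D.N m : ℝ)) • fun x : UnitAddTorus (Fin 3) => (D.word m).carrier (D.a m * t) (D.N m • x) := by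
  funext x
  simp only [FractalCarrierData.level, LatticeWord.cell, Pi.smul_apply, smul_smul]
  congr 1
  ring

/-- `‖level m t x‖ ≤ k a_m / (2π N_m)`. [folklore] -/
theorem norm_level_le (D : FractalCarrierData k) (m : ℕ) (t : ℝ) (x : UnitAddTorus (Fin 3)) :
    ‖D.level m t x‖ ≤ k * D.a m / (2 * Real.pi * D.N m) := by
  rw [level_eq_smul, Pi.smul_apply, norm_smul, Real.norm_eq_abs,
    abs_of_pos (div_pos (D.a_pos m) (by exact_mod_cast D.N_pos m))]
  calc D.a m / (D.N m : ℝ) * ‖(D.word m).carrier (D.a m * t) (D.N m • x)‖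
      ≤ D.a m / (D.N m : ℝ) * (k / (2 * Real.pi)) :=
        mul_le_mul_of_nonneg_left (norm_carrier_nsmul_le _ _ _ _) (div_pos (D.a_pos m) (by exact_mod_cast D.N_pos m)).le
    _ = k * D.a m / (2 * Real.pi * D.N m) := by ring

/-- The level fields are weakly divergence free. [folklore] -/
theorem isWeaklyDivFree_level (D : FractalCarrierData k) (m : ℕ) (t : ℝ) : IsWeaklyDivFree (D.level m t) := by
  rw [level_eq_smul]
  intro θ hθ
  have h := isWeaklyDivFree_carrier_nsmul (D.word m) (D.a m * t) (D.N m) θ hθ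
  simp only [Pi.smul_apply, real_inner_smul_left, integral_const_mul, h, mul_zero]

/-- The level fields are smooth in space. [folklore] -/
theorem isSmooth_level (D : FractalCarrierData k) (m : ℕ) (t : ℝ) : IsSmooth (D.level m t) := by
  rw [level_eq_smul]
  exact (isSmooth_carrier_nsmul _ _ _).smul _

/-- **`C^{0,r}` bound of the level fields**: `‖level m t‖_{C^{0,r}} ≤ 7 k a_m N_m^{r−1}` (`r ≤ 1`). [folklore] -/
theorem eBoundedHolderNorm_level_le (D : FractalCarrierData k) (m : ℕ) (t : ℝ) {r : ℝ≥0} (hr : r ≤ 1) :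
    eBoundedHolderNorm r (D.level m t) ≤ ENNReal.ofReal (7 * k * D.a m * (D.N m : ℝ) ^ ((r : ℝ) - 1)) := by
  have hN : 1 ≤ D.N m := D.N_pos m
  have hN0 : (0 : ℝ) < D.N m := by exact_mod_cast D.N_pos m
  rw [level_eq_smul, eBoundedHolderNorm_const_smul]
  have h1 := eBoundedHolderNorm_carrier_nsmul_le (D.word m) (D.a m * t) hN hr
  rw [← ofReal_norm, Real.norm_eq_abs, abs_of_pos (div_pos (D.a_pos m) hN0)]
  calc ENNReal.ofReal (D.a m / D.N m) * eBoundedHolderNorm r (fun y : UnitAddTorus (Fin 3) => (D.word m).carrier (D.a m * t) (D.N m • y))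
      ≤ ENNReal.ofReal (D.a m / D.N m) * ENNReal.ofReal (7 * k * (D.N m : ℝ) ^ (r : ℝ)) := by gcongr
    _ = ENNReal.ofReal (7 * k * D.a m * (D.N m : ℝ) ^ ((r : ℝ) - 1)) := by
        rw [← ENNReal.ofReal_mul (div_pos (D.a_pos m) hN0).le]
        congr 1
        rw [Real.rpow_sub hN0, Real.rpow_one]
        field_simp

/-- The difference of a level field at two times. [folklore] -/
theorem level_sub_eq_smul (D : FractalCarrierData k) (m : ℕ) (t t' : ℝ) :
    D.level m t - D.level m t' = (D.a m / (D.N m : ℝ)) • fun x : UnitAddTorus (Fin 3) =>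
      ((D.word m).carrier (D.a m * t) (D.N m • x) - (D.word m).carrier (D.a m * t') (D.N m • x)) := by
  rw [level_eq_smul, level_eq_smul, ← smul_sub]
  rfl

/-- **`C^{0,r}` bound of level differences in time**: with `Δⱼ` the envelope differences of the word `D.word m`
between the word times `a_m t` and `a_m t'`,
`‖level m t − level m t'‖_{C^{0,r}} ≤ 7 a_m N_m^{r−1} Σⱼ |Δⱼ|` (`r ≤ 1`). [folklore] -/
theorem eBoundedHolderNorm_level_sub_le (D : FractalCarrierData k) (m : ℕ) (t t' : ℝ) {r : ℝ≥0} (hr : r ≤ 1) :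
    eBoundedHolderNorm r (D.level m t - D.level m t') ≤ ENNReal.ofReal (7 * D.a m * (D.N m : ℝ) ^ ((r : ℝ) - 1) *
      ∑ j, |LatticeWord.trapezoid ((D.word m).start j) ((D.word m).phase j).τ (D.word m).ramp
            (Int.fract (D.a m * t / (D.word m).period) * (D.word m).period) -
          LatticeWord.trapezoid ((D.word m).start j) ((D.word m).phase j).τ (D.word m).ramp
            (Int.fract (D.a m * t' / (D.word m).period) * (D.word m).period)|) := by
  have hN : 1 ≤ D.N m := D.N_pos m
  have hN0 : (0 : ℝ) < D.N m := by exact_mod_cast D.N_pos m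
  rw [level_sub_eq_smul, eBoundedHolderNorm_const_smul]
  simp only [carrier_nsmul_sub]
  have h1 := eBoundedHolderNorm_layerComb_le (D.word m) (fun j =>
    LatticeWord.trapezoid ((D.word m).start j) ((D.word m).phase j).τ (D.word m).ramp
        (Int.fract (D.a m * t / (D.word m).period) * (D.word m).period) -
      LatticeWord.trapezoid ((D.word m).start j) ((D.word m).phase j).τ (D.word m).ramp
        (Int.fract (D.a m * t' / (D.word m).period) * (D.word m).period)) hN hr
  rw [← ofReal_norm, Real.norm_eq_abs, abs_of_pos (div_pos (D.a_pos m) hN0)]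
  refine (mul_le_mul_of_nonneg_left h1 bot_le).trans (le_of_eq ?_)
  rw [← ENNReal.ofReal_mul (div_pos (D.a_pos m) hN0).le]
  congr 1
  rw [Real.rpow_sub hN0, Real.rpow_one]
  field_simp

end Level

end Summit.AnomalousDissipation.AnomalousDissipation.Theorems.SolenoidalFractalHomogenisation.PermissibleCarrier

end
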